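import Mathlib
import Summits.ValiantsHypothesis.ValiantsHypothesis.Theorems.GrenetZeonTwoDimCoefficientsScalingSquarefreeDescent

/-!
# Crux `GrenetZeon.TwoDimCoefficients` (stmt-ValiantsHypothesis-8062), stub `stub_dualUnipotent`:
# scaling-closure — SQUAREFREE DESCENT BY SPECIALISATION (lemma F3a of memo EIGHTEENTH-HAND.md)

Companion of ✓ `squarefree_map_fractionRing_of_quasiHomogeneous` (descent by quasi-homogeneity).  In the
numerator-perturbation argument (memo EIGHTEENTH-HAND.md §NEW) the ray polynomial at the chosen point is
`R̃(u′, η) = c·det(1_r + u′(T + η·E)) ∈ ℂ[η][u′]` and its specialisation `η = 0` is the explicit squarefree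
polynomial `c·Π_{i ≤ r}(1 + i·u′)` of full degree `r`; one needs `R̃` squarefree over `ℂ(η)`:

* ★ `squarefree_map_fractionRing_of_specialization` — `R` a GCD domain with fraction field `K`, `φ : R → F` a ring
  map to a domain; if `p ∈ R[X]` keeps its degree under `φ` and `p.map φ` is squarefree, then `p` is squarefree in
  `K[X]`.  (Gauss/primPart descent of a square factor to `R[X]`, then degree bookkeeping under `φ`.)
* `exists_primitive_sq_dvd_of_not_isUnit` — the shared Gauss step, isolated: a non-unit `x ∈ K[X]` with `x² ∣ p.map`
  yields a primitive `S ∈ R[X]` with `S² ∣ p` and `x = (unit)·S.map`.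

HONEST FRAMING: generic commutative algebra; the stub `DualUnipotentBound`, both cruxes (stmt-8062, stmt-24318) and
`VP ≠ VNP` remain open.

References: folklore (Gauss's lemma).
-/

-- single-conjunct layout `Summits/ValiantsHypothesis/ValiantsHypothesis`: the duplicated namespace
-- component is mandated by the tree.
set_option linter.dupNamespace false
set_option autoImplicit false

noncomputable section

namespace Summit.ValiantsHypothesis.ValiantsHypothesis.Theorems.GrenetZeonTwoDimCoefficients.ScalingClosure

section Specialization

variable {R : Type*} [CommRing R] [IsDomain R] [IsGCDMonoid R]
variable {K : Type*} [Field K] [Algebra R K] [IsFractionRing R K]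

/-- **Gauss step.**  If `x ∈ K[X]` is not a unit, `x ≠ 0`, and `x·x ∣ p.map`, then some PRIMITIVE `S ∈ R[X]` of
positive degree has `S·S ∣ p`. [folklore] -/
theorem exists_primitive_sq_dvd (p : Polynomial R) {x : Polynomial K} (hx0 : x ≠ 0)
    (hx : x * x ∣ p.map (algebraMap R K)) :
    ∃ S : Polynomial R, S.IsPrimitive ∧ S * S ∣ p ∧ S.natDegree = x.natDegree := by
  classical
  have hinj : Function.Injective (algebraMap R K) := IsFractionRing.injective R K
  obtain ⟨b, hbM, hb⟩ := IsLocalization.integerNormalization_spec (nonZeroDivisors R) (S := K) x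
  set S₁ : Polynomial R := IsLocalization.integerNormalization (nonZeroDivisors R) x with hS₁
  have hb0 : (b : R) ≠ 0 := nonZeroDivisors.ne_zero hbM
  have hb0' : algebraMap R K b ≠ 0 := fun h => hb0 (hinj (by rw [h, map_zero]))
  letI : NormalizedGCDMonoid R := Nonempty.some inferInstance
  set S₀ : Polynomial R := S₁.primPart with hS₀
  have hS₁eq : S₁ = Polynomial.C S₁.content * S₀ := S₁.eq_C_content_mul_primPart
  have hS₁ne : S₁ ≠ 0 := by
    intro h
    have : (b : R) • x = 0 := by rw [← hb, h, Polynomial.map_zero]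
    exact (smul_ne_zero hb0 hx0) (by rwa [Algebra.smul_def, Polynomial.algebraMap_apply] at this ⊢)
  have hcont : algebraMap R K S₁.content ≠ 0 := fun h =>
    (mt Polynomial.content_eq_zero_iff.mp hS₁ne) (hinj (by rw [h, map_zero]))
  have hx_eq : x = Polynomial.C ((algebraMap R K b)⁻¹) * (Polynomial.C (algebraMap R K S₁.content) *
      S₀.map (algebraMap R K)) := by
    have h1 : S₁.map (algebraMap R K) = b • x := hb
    rw [hS₁eq, Polynomial.map_mul, Polynomial.map_C, Algebra.smul_def, Polynomial.algebraMap_apply] at h1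
    rw [h1, ← mul_assoc, ← Polynomial.C_mul, inv_mul_cancel₀ hb0', Polynomial.C_1, one_mul]
  have hxS₀ : S₀.map (algebraMap R K) ∣ x :=
    ⟨Polynomial.C ((algebraMap R K b)⁻¹ * algebraMap R K S₁.content), by rw [hx_eq, Polynomial.C_mul]; ring⟩
  have hdvdK : (S₀ * S₀).map (algebraMap R K) ∣ p.map (algebraMap R K) := by
    rw [Polynomial.map_mul]
    exact (mul_dvd_mul hxS₀ hxS₀).trans hx
  have hprim : (S₀ * S₀).IsPrimitive := (S₁.isPrimitive_primPart).mul S₁.isPrimitive_primPart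
  refine ⟨S₀, S₁.isPrimitive_primPart, hprim.dvd_of_fraction_map_dvd_fraction_map hdvdK, ?_⟩
  -- degrees: `x = C u * S₀.map`, `u ≠ 0`
  rw [hx_eq, ← mul_assoc, ← Polynomial.C_mul, Polynomial.natDegree_C_mul
    (mul_ne_zero (inv_ne_zero hb0') hcont), Polynomial.natDegree_map_eq_of_injective hinj, hS₀,
    Polynomial.natDegree_primPart]

/-- ★ **Squarefree descent by specialisation.**  `φ : R → F` a ring map to a domain; if `p ∈ R[X]` keeps its
degree under `φ` and `p.map φ` is squarefree, then `p` is squarefree over the fraction field `K` of `R`. [folklore] -/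
theorem squarefree_map_fractionRing_of_specialization {F : Type*} [CommRing F] [IsDomain F] (φ : R →+* F)
    (p : Polynomial R) (hdeg : (p.map φ).natDegree = p.natDegree) (hsq : Squarefree (p.map φ)) :
    Squarefree (p.map (algebraMap R K)) := by
  classical
  have hinj : Function.Injective (algebraMap R K) := IsFractionRing.injective R K
  have hpφ0 : p.map φ ≠ 0 := hsq.ne_zero
  have hp0 : p ≠ 0 := fun h => hpφ0 (by rw [h, Polynomial.map_zero])
  intro x hx
  have hx0 : x ≠ 0 := by
    rintro rfl
    rw [zero_mul, zero_dvd_iff, Polynomial.map_eq_zero_iff hinj] at hx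
    exact hp0 hx
  obtain ⟨S, -, ⟨T, hT⟩, hSdeg⟩ := exists_primitive_sq_dvd (K := K) p hx0 hx
  -- degree bookkeeping under `φ`
  have hS0 : S ≠ 0 := fun h => hp0 (by rw [hT, h, zero_mul, zero_mul])
  have hT0 : T ≠ 0 := fun h => hp0 (by rw [hT, h, mul_zero])
  have hmap : p.map φ = S.map φ * S.map φ * T.map φ := by rw [hT, Polynomial.map_mul, Polynomial.map_mul]
  have hSφ0 : S.map φ ≠ 0 := fun h => hpφ0 (by rw [hmap, h, zero_mul, zero_mul])
  have hTφ0 : T.map φ ≠ 0 := fun h => hpφ0 (by rw [hmap, h, mul_zero])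
  have hdegp : p.natDegree = S.natDegree + S.natDegree + T.natDegree := by
    rw [hT, Polynomial.natDegree_mul (mul_ne_zero hS0 hS0) hT0, Polynomial.natDegree_mul hS0 hS0]
  have hdegφ : (p.map φ).natDegree = (S.map φ).natDegree + (S.map φ).natDegree + (T.map φ).natDegree := by
    rw [hmap, Polynomial.natDegree_mul (mul_ne_zero hSφ0 hSφ0) hTφ0, Polynomial.natDegree_mul hSφ0 hSφ0]
  have hSle : (S.map φ).natDegree ≤ S.natDegree := Polynomial.natDegree_map_le
  have hTle : (T.map φ).natDegree ≤ T.natDegree := Polynomial.natDegree_map_le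
  have hSeq : (S.map φ).natDegree = S.natDegree := by omega
  -- `S.map φ` is a unit (squarefreeness of `p.map φ`), hence `deg S = 0`, hence `x` is a unit
  have hunit : IsUnit (S.map φ) := hsq _ ⟨T.map φ, hmap⟩
  have hdeg0 : x.natDegree = 0 := by
    rw [← hSdeg, ← hSeq]; exact Polynomial.natDegree_eq_zero_of_isUnit hunit
  rw [Polynomial.eq_C_of_natDegree_eq_zero hdeg0]
  refine Polynomial.isUnit_C.mpr (IsUnit.mk0 _ fun h => hx0 ?_)
  rw [Polynomial.eq_C_of_natDegree_eq_zero hdeg0, h, Polynomial.C_0]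

end Specialization

end Summit.ValiantsHypothesis.ValiantsHypothesis.Theorems.GrenetZeonTwoDimCoefficients.ScalingClosure

end
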